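import Mathlib
import Literature.Combinatorics.Optimization.NonnegativeRankConicalJuntas
import HarnessLib

/-!
# Kothari–Meka–Raghavendra 2017, §6: decomposing high-min-entropy product distributions into aligned
# conjunctive blockwise-dense pieces — Theorem 2.11 / 6.4 PROVED; Theorem 1.10 PROVED unconditionally

This file discharges the typed fact `KothariMekaRaghavendra2017_thm211` (KMR Thm 2.11 = Thm 6.4, product
case; `NonnegativeRankConicalJuntas.lean`) as the theorem `KothariMekaRaghavendra2017_thm211_holds`, and with
it the engine fact `KothariMekaRaghavendra2017_thm110` (KMR Thm 1.10, `LPRelaxationsMaxCSP.lean`) as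
`KothariMekaRaghavendra2017_thm110_holds := KothariMekaRaghavendra2017_thm110_of_thm211 thm211_holds`.

## The printed proof (§6.3–6.4) and how it is formalised

KMR decompose `A × B ⊆ [q]^n × [q]^n` recursively (`Decompose / XDecompose / YDecompose`, §6.3): at a node
with fixed blocks `F` (`|F| < d`), while the current rectangle keeps a `δ`-fraction of the node's mass, either
both marginals are blockwise-dense off `F` (output a good leaf), or some block set `S` and value `ξ` are HEAVY
on one side (`Pr[X_S = ξ] > q^{−0.8|S|}`); then `A_{|S=ξ} × B_{|S=β}` is decomposed at `F ∪ S` for every `β`,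
and the loop continues with `A_{|S≠ξ} × B`; below mass `δ` the rest is `Error_a`, at `|F| ≥ d` it is `Error_b`.
We formalise the algorithm as an EXISTENCE statement (`HasRectDecomp`: a list of good rectangles + a
non-negative error function with a mass bound), proved by a double induction — on the depth budget
`d − |F|` (`hasRectDecomp_depth`) and, inside one call, on `|A| + |B|` (`loopClaim_all`, both row/column
orders at once via `HasRectDecomp.swap`).  The error analysis of §6.4 is carried by ONE compositional
invariant instead of the printed global path sums (Lemmas 6.12–6.16):

* node bound: `Err(A × B, F) ≤ (d − |F|) δ P(A)Q(B) + T σ^{4d} σ^{36|F|} L^{d−|F|}`, where `q = 2^b`,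
  `σ = q^{−1/20}`, `θ = σ^{16} = q^{−0.8}`, `(q^n P)(q^n Q) ≤ T = 2^t`, `L = ln(1/δ) + 1`;
* bad leaves (`|F| ≥ d`): `P(A)Q(B) ≤ T q^{−2|F|} = T σ^{40|F|}` (Lemma 6.11, product form:
  `massOn_mul_massOn_le`, from the fibre count `card_filter_blockRestrict`);
* one call (Lemma 6.6's `δ` per call; Lemmas 6.10 + 6.13–6.15 replaced by the potential
  `K (ln(M/(δM₀)) + 1)`): a heavy step of relative mass `m₁/M > θ^{|S|}` costs, through the `q^{|S|}` deeper
  calls, `q^{|S|} · T σ^{4d} σ^{36(|F|+|S|)} L^{d−|F|−|S|} ≤ K θ^{|S|} < K m₁/M ≤ K ln(M/M')`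
  (`hasRectDecomp_step`; `1 − x⁻¹ ≤ ln x`), which telescopes along the loop to `K (ln(1/δ) + 1) ≤ K L`;
  here `K = T σ^{4d} σ^{36|F|} L^{d−|F|−1}` and `θ/q = σ^{36}`.
At the root this gives `Err ≤ dδ + T σ^{4d} L^d` (the printed `dδ + q^{−0.1d} 2^t (⌈log 1/δ⌉+2)^d`, with the
better exponent `0.2d` that the product structure allows), and with `δ = σ^d = q^{−0.05d}` the final
arithmetic `KMR_thm64_final_arith` (`e^{3u} ≥ 1 + 3u`) yields the printed `2^t (d q^{−0.05})^d` in the only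
non-trivial regime (`d ≥ 5`, `2^t > q^{0.2}`; otherwise the bound is `≥ 1`, or `P, Q` are already
blockwise-dense — `one_lt_of_not_denseOn_univ`).  The good leaves are normalised into the data of
`HasAlignedDecomposition θ θ d · P Q` by `hasAlignedDecomposition_of_hasRectDecomp`.

Also PROVED here, as printed: the elementary **Lemma 6.13** (`KothariMekaRaghavendra2017_lemma613`, by the
telescoping `a_j/s_j ≤ ln(s_j/s_{j+1})` instead of the dyadic grouping).

No new facts; every theorem is proved.  Vocabulary reused from `BlockwiseDenseInnerProduct.lean`
(`blockRestrict`, `blockMass`, `HasAlignedDecomposition`) and `NonnegativeRankConicalJuntas.lean`.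

## References
* [KothariMekaRaghavendra2017] P. K. Kothari, R. Meka, P. Raghavendra, *Approximating rectangles by juntas
  and weakly-exponential lower bounds for LP relaxations of CSPs*, STOC 2017 / SIAM J. Comput. 51 (2022),
  arXiv:1610.02704 — §6 (Lemma 6.1, Thm 6.4, the algorithm §6.3, Lemmas 6.5–6.16), Thm 2.11, Thm 1.10.
-/

noncomputable section

open Finset

namespace Literature.Combinatorics.Optimization

/-! ### Lemma 6.13 (elementary) -/

/-- **Kothari–Meka–Raghavendra 2017, Lemma 6.13 — PROVED.** "Let `a_1, …, a_N ∈ (0,1)` be such that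
`Σ a_i = 1` and `a_{N−1} + a_N ≥ ε`. Then `Σ_{j=1}^N a_j/(Σ_{i≥j} a_i) ≤ ⌈log(1/ε)⌉ + 2`" (logarithms base 2).
Indexing from `0`: `a : ℕ → ℝ` positive on `[0,N)`, `N ≥ 2`, tail sums `s_j = Σ_{j ≤ i < N} a_i`. Proof (shorter
than the printed dyadic grouping): for `j ≤ N−3`, `a_j/s_j = 1 − s_{j+1}/s_j ≤ ln(s_j/s_{j+1})`, which telescopes to
`ln(1/s_{N−2}) ≤ ln(1/ε) ≤ log₂(1/ε)`; the last two terms are `≤ 1` each.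
[cite: KothariMekaRaghavendra2017, Lemma 6.13 (§6.4)] -/
theorem KothariMekaRaghavendra2017_lemma613 {N : ℕ} (hN : 2 ≤ N) (a : ℕ → ℝ) (ha : ∀ i, i < N → 0 < a i)
    (hsum : ∑ i ∈ range N, a i = 1) {ε : ℝ} (hε : 0 < ε) (hlast : ε ≤ a (N - 2) + a (N - 1)) :
    ∑ j ∈ range N, a j / (∑ i ∈ Ico j N, a i) ≤ (⌈Real.logb 2 (1 / ε)⌉₊ : ℝ) + 2 := by
  -- tail sums
  set s : ℕ → ℝ := fun j => ∑ i ∈ Ico j N, a i with hs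
  have hs_succ : ∀ j, j < N → s j = a j + s (j + 1) := by
    intro j hj
    simp only [hs]
    rw [Finset.sum_eq_sum_Ico_succ_bot hj]
  have hs_nonneg : ∀ j, 0 ≤ s j := fun j =>
    sum_nonneg fun i hi => (ha i (mem_Ico.1 hi).2).le
  have hs_pos : ∀ j, j < N → 0 < s j := by
    intro j hj
    rw [hs_succ j hj]
    exact add_pos_of_pos_of_nonneg (ha j hj) (hs_nonneg _)
  have hs0 : s 0 = 1 := by simp only [hs]; rw [← hsum, Nat.Ico_zero_eq_range]
  have hsN2 : s (N - 2) = a (N - 2) + a (N - 1) := by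
    rw [hs_succ (N - 2) (by omega), show N - 2 + 1 = N - 1 by omega, hs_succ (N - 1) (by omega),
      show N - 1 + 1 = N by omega]
    simp [hs]
  have ha_le_s : ∀ j, j < N → a j ≤ s j := by
    intro j hj; rw [hs_succ j hj]; linarith [hs_nonneg (j + 1)]
  have hterm_le_one : ∀ j, j < N → a j / s j ≤ 1 := fun j hj =>
    (div_le_one (hs_pos j hj)).2 (ha_le_s j hj)
  -- split off the last two terms
  have hsplit : ∑ j ∈ range N, a j / s j =
      ∑ j ∈ range (N - 2), a j / s j + (a (N - 2) / s (N - 2) + a (N - 1) / s (N - 1)) := by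
    rw [show N = N - 2 + 1 + 1 by omega, Finset.sum_range_succ, Finset.sum_range_succ]
    rw [show N - 2 + 1 + 1 - 2 = N - 2 by omega, show N - 2 + 1 + 1 - 1 = N - 2 + 1 by omega]
    ring
  -- the telescoping bound for the first `N − 2` terms
  have htele : ∑ j ∈ range (N - 2), a j / s j ≤ Real.log (1 / ε) := by
    calc ∑ j ∈ range (N - 2), a j / s j
        ≤ ∑ j ∈ range (N - 2), (Real.log (s j) - Real.log (s (j + 1))) := by
          refine sum_le_sum fun j hj => ?_
          have hjN : j < N := by have := mem_range.1 hj; omega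
          have hj1N : j + 1 < N := by have := mem_range.1 hj; omega
          have e : a j / s j = 1 - (s j / s (j + 1))⁻¹ := by
            rw [inv_div, eq_sub_iff_add_eq, ← add_div, ← hs_succ j hjN, div_self (hs_pos j hjN).ne']
          rw [e, ← Real.log_div (hs_pos j hjN).ne' (hs_pos (j + 1) hj1N).ne']
          exact Real.one_sub_inv_le_log_of_pos (div_pos (hs_pos j hjN) (hs_pos (j + 1) hj1N))
      _ = Real.log (s 0) - Real.log (s (N - 2)) := Finset.sum_range_sub' (fun j => Real.log (s j)) (N - 2)
      _ ≤ Real.log (1 / ε) := by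
          rw [hs0, Real.log_one, zero_sub, one_div, Real.log_inv]
          exact neg_le_neg (Real.log_le_log hε (by rw [hsN2]; exact hlast))
  -- `ln ≤ log₂ ≤ ⌈log₂⌉`
  have hε1 : ε ≤ 1 := by
    have h2 : a (N - 2) + a (N - 1) ≤ 1 := by
      rw [← hsN2, ← hs0]
      simp only [hs]
      exact Finset.sum_le_sum_of_subset_of_nonneg (Finset.Ico_subset_Ico (Nat.zero_le _) le_rfl)
        fun i hi _ => (ha i (mem_Ico.1 hi).2).le
    linarith
  have hlog : Real.log (1 / ε) ≤ (⌈Real.logb 2 (1 / ε)⌉₊ : ℝ) := by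
    have h1 : 0 ≤ Real.log (1 / ε) := Real.log_nonneg (by rw [le_div_iff₀ hε]; linarith)
    have h2 : Real.log (1 / ε) ≤ Real.logb 2 (1 / ε) := by
      rw [← Real.log_div_log]
      have hl2 : 0 < Real.log 2 := Real.log_pos (by norm_num)
      have hl2' : Real.log 2 < 1 := by
        have := Real.log_two_lt_d9; linarith
      rw [le_div_iff₀ hl2]
      nlinarith
    exact h2.trans (Nat.le_ceil _)
  rw [hsplit]
  linarith [hterm_le_one (N - 2) (by omega), hterm_le_one (N - 1) (by omega)]

/-! ### Sub-rectangles, restricted masses, blockwise density on a sub-rectangle (§6.2–6.3 vocabulary) -/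

section Rectangles

variable {n b : ℕ}

/-- The mass `P(A) = Σ_{x∈A} P(x)` of a set of block strings. [cite: KothariMekaRaghavendra2017, §6 ("μ(S) = Pr_{X∼μ}[X ∈ S]")] -/
def massOn (P : (Fin n → Fin b → Bool) → ℝ) (A : Finset (Fin n → Fin b → Bool)) : ℝ := ∑ x ∈ A, P x

/-- The mass of `A ∩ {x_J = ξ}`. [cite: KothariMekaRaghavendra2017, §6.1 ("Pr_{μ|S}[Y_I = α]")] -/
def bmassOn (P : (Fin n → Fin b → Bool) → ℝ) (A : Finset (Fin n → Fin b → Bool)) (J : Finset (Fin n))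
    (ξ : (↥J × Fin b) → Bool) : ℝ :=
  ∑ x ∈ A.filter (fun x => blockRestrict J x = ξ), P x

/-- `P|_A` is `θ`-blockwise-dense off the blocks `F`: every `J`-block marginal with `J ∩ F = ∅` has
conditional max-probability `≤ θ^{|J|}`. [cite: KothariMekaRaghavendra2017, Def. 2.8/2.9 and §6.3 ("X_{F̄}, Y_{F̄} are blockwise-dense")] -/
def DenseOn (θ : ℝ) (P : (Fin n → Fin b → Bool) → ℝ) (A : Finset (Fin n → Fin b → Bool)) (F : Finset (Fin n)) :
    Prop :=
  ∀ J : Finset (Fin n), Disjoint J F → ∀ ξ, bmassOn P A J ξ ≤ θ ^ J.card * massOn P A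

/-- All strings of `A` agree with `α` on the blocks `F`. [cite: KothariMekaRaghavendra2017, §6.3 ("Invariant: A_F, B_F are fixed")] -/
def FixedOn (A : Finset (Fin n → Fin b → Bool)) (F : Finset (Fin n)) (α : Fin n → Fin b → Bool) : Prop :=
  ∀ x ∈ A, ∀ j ∈ F, x j = α j

/-- The restriction of the product measure `P ⊗ Q` to the rectangle `A × B`, as a function.
[cite: KothariMekaRaghavendra2017, §6.2 ("μ_{|R}")] -/
def rectFun (P Q : (Fin n → Fin b → Bool) → ℝ) (A B : Finset (Fin n → Fin b → Bool)) :
    (Fin n → Fin b → Bool) → (Fin n → Fin b → Bool) → ℝ :=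
  fun x y => if x ∈ A ∧ y ∈ B then P x * Q y else 0

/-- A rectangle with its common fixed blocks and fixed values. [cite: KothariMekaRaghavendra2017, §6.3 (the nodes (A × B, F) of the decomposition algorithm)] -/
structure Rect (n b : ℕ) where
  /-- rows -/
  A : Finset (Fin n → Fin b → Bool)
  /-- columns -/
  B : Finset (Fin n → Fin b → Bool)
  /-- fixed blocks -/
  F : Finset (Fin n)
  /-- fixed row values -/
  α : Fin n → Fin b → Bool
  /-- fixed column values -/
  β : Fin n → Fin b → Bool

/-- A good leaf of the decomposition: an aligned `d`-CBD rectangle of positive mass.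
[cite: KothariMekaRaghavendra2017, Lemma 6.5 (§6.4)] -/
def Rect.Good (θ : ℝ) (d : ℕ) (P Q : (Fin n → Fin b → Bool) → ℝ) (R : Rect n b) : Prop :=
  FixedOn R.A R.F R.α ∧ FixedOn R.B R.F R.β ∧ DenseOn θ P R.A R.F ∧ DenseOn θ Q R.B R.F ∧ R.F.card ≤ d ∧
    0 < massOn P R.A ∧ 0 < massOn Q R.B

/-- **A rectangular decomposition of `(P ⊗ Q)|_{A×B}`** into good rectangles plus a non-negative error of
total mass `≤ E` (the output of the decomposition algorithm below a node). [cite: KothariMekaRaghavendra2017, Thm 6.4 (§6.2)] -/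
def HasRectDecomp (θ : ℝ) (d : ℕ) (P Q : (Fin n → Fin b → Bool) → ℝ) (A B : Finset (Fin n → Fin b → Bool))
    (E : ℝ) : Prop :=
  ∃ (L : List (Rect n b)) (Err : (Fin n → Fin b → Bool) → (Fin n → Fin b → Bool) → ℝ),
    (∀ R ∈ L, R.Good θ d P Q) ∧ (∀ x y, 0 ≤ Err x y) ∧
    (∀ x y, rectFun P Q A B x y = (L.map fun R => rectFun P Q R.A R.B x y).sum + Err x y) ∧
    ∑ x, ∑ y, Err x y ≤ E

variable {P Q : (Fin n → Fin b → Bool) → ℝ}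

/-- `P(A) ≥ 0`. [cite: KothariMekaRaghavendra2017, §6] -/
theorem massOn_nonneg (hP : ∀ x, 0 ≤ P x) (A : Finset (Fin n → Fin b → Bool)) : 0 ≤ massOn P A :=
  sum_nonneg fun x _ => hP x

/-- `bmassOn ≥ 0`. [cite: KothariMekaRaghavendra2017, §6] -/
theorem bmassOn_nonneg (hP : ∀ x, 0 ≤ P x) (A : Finset (Fin n → Fin b → Bool)) (J : Finset (Fin n))
    (ξ : (↥J × Fin b) → Bool) : 0 ≤ bmassOn P A J ξ :=
  sum_nonneg fun x _ => hP x

/-- `bmassOn P A J ξ = massOn P (A ∩ {x_J = ξ})`. [cite: KothariMekaRaghavendra2017, §6] -/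
theorem bmassOn_eq_massOn_filter (A : Finset (Fin n → Fin b → Bool)) (J : Finset (Fin n))
    (ξ : (↥J × Fin b) → Bool) : bmassOn P A J ξ = massOn P (A.filter fun x => blockRestrict J x = ξ) := rfl

/-- Monotonicity of the mass. [cite: KothariMekaRaghavendra2017, §6] -/
theorem massOn_mono (hP : ∀ x, 0 ≤ P x) {A A' : Finset (Fin n → Fin b → Bool)} (h : A ⊆ A') :
    massOn P A ≤ massOn P A' :=
  Finset.sum_le_sum_of_subset_of_nonneg h fun x _ _ => hP x

/-- Additivity of the mass over a filter split. [cite: KothariMekaRaghavendra2017, §6] -/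
theorem massOn_filter_add (A : Finset (Fin n → Fin b → Bool)) (p : (Fin n → Fin b → Bool) → Prop)
    [DecidablePred p] : massOn P (A.filter p) + massOn P (A.filter fun x => ¬ p x) = massOn P A := by
  unfold massOn; exact Finset.sum_filter_add_sum_filter_not A p _

/-- `Σ_{x,y} (P⊗Q)|_{A×B} = P(A) Q(B)`. [cite: KothariMekaRaghavendra2017, §6.2 ("μ(R)")] -/
theorem sum_rectFun (A B : Finset (Fin n → Fin b → Bool)) :
    ∑ x, ∑ y, rectFun P Q A B x y = massOn P A * massOn Q B := by
  classical
  unfold rectFun massOn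
  rw [Finset.sum_mul_sum, ← Finset.sum_filter_add_sum_filter_not univ (fun x => x ∈ A)]
  have h1 : ∑ x ∈ univ.filter (fun x => ¬ x ∈ A), ∑ y, (if x ∈ A ∧ y ∈ B then P x * Q y else 0) = 0 :=
    Finset.sum_eq_zero fun x hx => Finset.sum_eq_zero fun y _ => by
      rw [if_neg (fun h => (mem_filter.1 hx).2 h.1)]
  rw [h1, add_zero, Finset.filter_mem_eq_inter, Finset.univ_inter]
  refine sum_congr rfl fun x hx => ?_
  rw [← Finset.sum_filter_add_sum_filter_not univ (fun y => y ∈ B)]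
  have h2 : ∑ y ∈ univ.filter (fun y => ¬ y ∈ B), (if x ∈ A ∧ y ∈ B then P x * Q y else 0) = 0 :=
    Finset.sum_eq_zero fun y hy => by rw [if_neg (fun h => (mem_filter.1 hy).2 h.2)]
  rw [h2, add_zero, Finset.filter_mem_eq_inter, Finset.univ_inter]
  exact sum_congr rfl fun y hy => by rw [if_pos ⟨hx, hy⟩]

/-- `(P⊗Q)|_{A×B} ≥ 0`. [cite: KothariMekaRaghavendra2017, §6.2] -/
theorem rectFun_nonneg (hP : ∀ x, 0 ≤ P x) (hQ : ∀ y, 0 ≤ Q y) (A B : Finset (Fin n → Fin b → Bool))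
    (x y : Fin n → Fin b → Bool) : 0 ≤ rectFun P Q A B x y := by
  unfold rectFun; split_ifs
  · exact mul_nonneg (hP x) (hQ y)
  · exact le_rfl

/-- Splitting the rows: `(P⊗Q)|_{A×B} = (P⊗Q)|_{A₁×B} + (P⊗Q)|_{A₂×B}` for `A = A₁ ⊔ A₂` (filter split).
[cite: KothariMekaRaghavendra2017, §6.3 (A_{|S=α}, A_{|S≠α})] -/
theorem rectFun_filter_add (A B : Finset (Fin n → Fin b → Bool)) (p : (Fin n → Fin b → Bool) → Prop)
    [DecidablePred p] (x y : Fin n → Fin b → Bool) :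
    rectFun P Q (A.filter p) B x y + rectFun P Q (A.filter fun x => ¬ p x) B x y = rectFun P Q A B x y := by
  unfold rectFun
  by_cases hx : x ∈ A
  · by_cases hp : p x
    · simp [mem_filter, hx, hp]
    · simp [mem_filter, hx, hp]
  · simp [mem_filter, hx]

/-- Splitting the columns. [cite: KothariMekaRaghavendra2017, §6.3 (B_{|S=β})] -/
theorem rectFun_filter_add' (A B : Finset (Fin n → Fin b → Bool)) (p : (Fin n → Fin b → Bool) → Prop)
    [DecidablePred p] (x y : Fin n → Fin b → Bool) :
    rectFun P Q A (B.filter p) x y + rectFun P Q A (B.filter fun y => ¬ p y) x y = rectFun P Q A B x y := by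
  unfold rectFun
  by_cases hy : y ∈ B
  · by_cases hp : p y
    · simp [mem_filter, hy, hp]
    · simp [mem_filter, hy, hp]
  · simp [mem_filter, hy]

/-- Weakening the error bound. [cite: KothariMekaRaghavendra2017, Thm 6.4] -/
theorem HasRectDecomp.mono {θ : ℝ} {d : ℕ} {A B : Finset (Fin n → Fin b → Bool)} {E E' : ℝ}
    (h : HasRectDecomp θ d P Q A B E) (hE : E ≤ E') : HasRectDecomp θ d P Q A B E' := by
  obtain ⟨L, Err, hL, hErr0, hrep, hErr⟩ := h
  exact ⟨L, Err, hL, hErr0, hrep, hErr.trans hE⟩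

/-- Everything into the error. [cite: KothariMekaRaghavendra2017, §6.3 (Error_a / Error_b leaves)] -/
theorem hasRectDecomp_error (hP : ∀ x, 0 ≤ P x) (hQ : ∀ y, 0 ≤ Q y) (θ : ℝ) (d : ℕ)
    (A B : Finset (Fin n → Fin b → Bool)) : HasRectDecomp θ d P Q A B (massOn P A * massOn Q B) :=
  ⟨[], rectFun P Q A B, fun R hR => by simp at hR, rectFun_nonneg hP hQ A B, fun x y => by simp,
    (sum_rectFun A B).le⟩

/-- A single good rectangle, no error. [cite: KothariMekaRaghavendra2017, Lemma 6.5] -/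
theorem hasRectDecomp_good {θ : ℝ} {d : ℕ} {R : Rect n b} (hR : R.Good θ d P Q) :
    HasRectDecomp θ d P Q R.A R.B 0 :=
  ⟨[R], fun _ _ => 0, fun R' hR' => by simp at hR'; rw [hR']; exact hR, fun _ _ => le_rfl,
    fun x y => by simp, by simp⟩

/-- Combining the decompositions of a row split. [cite: KothariMekaRaghavendra2017, §6.3] -/
theorem HasRectDecomp.union_filter {θ : ℝ} {d : ℕ} {A B : Finset (Fin n → Fin b → Bool)}
    (p : (Fin n → Fin b → Bool) → Prop) [DecidablePred p] {E₁ E₂ : ℝ}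
    (h₁ : HasRectDecomp θ d P Q (A.filter p) B E₁) (h₂ : HasRectDecomp θ d P Q (A.filter fun x => ¬ p x) B E₂) :
    HasRectDecomp θ d P Q A B (E₁ + E₂) := by
  obtain ⟨L₁, Err₁, hL₁, hE₁0, hrep₁, hE₁⟩ := h₁
  obtain ⟨L₂, Err₂, hL₂, hE₂0, hrep₂, hE₂⟩ := h₂
  refine ⟨L₁ ++ L₂, fun x y => Err₁ x y + Err₂ x y, fun R hR => ?_, fun x y => add_nonneg (hE₁0 x y) (hE₂0 x y),
    fun x y => ?_, ?_⟩
  · rcases List.mem_append.1 hR with h | h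
    · exact hL₁ R h
    · exact hL₂ R h
  · rw [← rectFun_filter_add A B p x y, hrep₁ x y, hrep₂ x y, List.map_append, List.sum_append]
    ring
  · have : ∑ x, ∑ y, (Err₁ x y + Err₂ x y) = ∑ x, ∑ y, Err₁ x y + ∑ x, ∑ y, Err₂ x y := by
      rw [← Finset.sum_add_distrib]
      exact sum_congr rfl fun x _ => Finset.sum_add_distrib
    rw [this]; exact add_le_add hE₁ hE₂

/-- Combining the decompositions of a column split. [cite: KothariMekaRaghavendra2017, §6.3] -/
theorem HasRectDecomp.union_filter' {θ : ℝ} {d : ℕ} {A B : Finset (Fin n → Fin b → Bool)}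
    (p : (Fin n → Fin b → Bool) → Prop) [DecidablePred p] {E₁ E₂ : ℝ}
    (h₁ : HasRectDecomp θ d P Q A (B.filter p) E₁) (h₂ : HasRectDecomp θ d P Q A (B.filter fun y => ¬ p y) E₂) :
    HasRectDecomp θ d P Q A B (E₁ + E₂) := by
  obtain ⟨L₁, Err₁, hL₁, hE₁0, hrep₁, hE₁⟩ := h₁
  obtain ⟨L₂, Err₂, hL₂, hE₂0, hrep₂, hE₂⟩ := h₂
  refine ⟨L₁ ++ L₂, fun x y => Err₁ x y + Err₂ x y, fun R hR => ?_, fun x y => add_nonneg (hE₁0 x y) (hE₂0 x y),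
    fun x y => ?_, ?_⟩
  · rcases List.mem_append.1 hR with h | h
    · exact hL₁ R h
    · exact hL₂ R h
  · rw [← rectFun_filter_add' A B p x y, hrep₁ x y, hrep₂ x y, List.map_append, List.sum_append]
    ring
  · have : ∑ x, ∑ y, (Err₁ x y + Err₂ x y) = ∑ x, ∑ y, Err₁ x y + ∑ x, ∑ y, Err₂ x y := by
      rw [← Finset.sum_add_distrib]
      exact sum_congr rfl fun x _ => Finset.sum_add_distrib
    rw [this]; exact add_le_add hE₁ hE₂

/-- Decomposing every column fibre `B ∩ {y_S = β}`, `β` ranging over a finite set `T` of values, decomposes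
`A × (B ∩ {y_S ∈ T})` with the sum of the error bounds. [cite: KothariMekaRaghavendra2017, §6.3 (XDecompose: "For every β ∈ [q]^S, Decompose(A × B_{|S=β}, F ∪ S)")] -/
theorem hasRectDecomp_fibres {θ : ℝ} {d : ℕ} {A B : Finset (Fin n → Fin b → Bool)} (S : Finset (Fin n))
    (E : ((↥S × Fin b) → Bool) → ℝ)
    (h : ∀ β, HasRectDecomp θ d P Q A (B.filter fun y => blockRestrict S y = β) (E β))
    (T : Finset ((↥S × Fin b) → Bool)) :
    HasRectDecomp θ d P Q A (B.filter fun y => blockRestrict S y ∈ T) (∑ β ∈ T, E β) := by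
  classical
  induction T using Finset.induction_on with
  | empty =>
    refine ⟨[], fun _ _ => 0, fun R hR => by simp at hR, fun _ _ => le_rfl, fun x y => ?_, by simp⟩
    simp [rectFun]
  | insert β T hβ ih =>
    rw [Finset.sum_insert hβ]
    have e1 : (B.filter fun y => blockRestrict S y ∈ insert β T).filter (fun y => blockRestrict S y = β) =
        B.filter fun y => blockRestrict S y = β := by
      ext y; simp only [mem_filter, mem_insert]
      constructor
      · rintro ⟨⟨hy, -⟩, h2⟩; exact ⟨hy, h2⟩
      · rintro ⟨hy, h2⟩; exact ⟨⟨hy, Or.inl h2⟩, h2⟩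
    have e2 : (B.filter fun y => blockRestrict S y ∈ insert β T).filter (fun y => ¬ blockRestrict S y = β) =
        B.filter fun y => blockRestrict S y ∈ T := by
      ext y; simp only [mem_filter, mem_insert]
      constructor
      · rintro ⟨⟨hy, h1⟩, h2⟩
        exact ⟨hy, h1.resolve_left h2⟩
      · rintro ⟨hy, h2⟩
        exact ⟨⟨hy, Or.inr h2⟩, fun h3 => hβ (h3 ▸ h2)⟩
    have h₁ := h β
    rw [← e1] at h₁
    have h₂ := ih
    rw [← e2] at h₂
    exact h₁.union_filter' _ h₂

/-- All column fibres at once. [cite: KothariMekaRaghavendra2017, §6.3 (XDecompose)] -/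
theorem hasRectDecomp_fibres_univ {θ : ℝ} {d : ℕ} {A B : Finset (Fin n → Fin b → Bool)} (S : Finset (Fin n))
    (E : ((↥S × Fin b) → Bool) → ℝ)
    (h : ∀ β, HasRectDecomp θ d P Q A (B.filter fun y => blockRestrict S y = β) (E β)) :
    HasRectDecomp θ d P Q A B (∑ β, E β) := by
  have := hasRectDecomp_fibres S E h univ
  have e : (B.filter fun y => blockRestrict S y ∈ (univ : Finset ((↥S × Fin b) → Bool))) = B := by
    ext y; simp
  rwa [e] at this

/-- Swapping the roles of rows and columns. [cite: KothariMekaRaghavendra2017, §6.3 (XDecompose/YDecompose are symmetric)] -/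
theorem HasRectDecomp.swap {θ : ℝ} {d : ℕ} {A B : Finset (Fin n → Fin b → Bool)} {E : ℝ}
    (h : HasRectDecomp θ d P Q A B E) : HasRectDecomp θ d Q P B A E := by
  obtain ⟨L, Err, hL, hErr0, hrep, hErr⟩ := h
  refine ⟨L.map fun R => ⟨R.B, R.A, R.F, R.β, R.α⟩, fun x y => Err y x, fun R hR => ?_,
    fun x y => hErr0 y x, fun x y => ?_, ?_⟩
  · obtain ⟨R', hR', rfl⟩ := List.mem_map.1 hR
    obtain ⟨h1, h2, h3, h4, h5, h6, h7⟩ := hL R' hR'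
    exact ⟨h2, h1, h4, h3, h5, h7, h6⟩
  · have e : ∀ (A' B' : Finset (Fin n → Fin b → Bool)), rectFun Q P B' A' x y = rectFun P Q A' B' y x := by
      intro A' B'
      unfold rectFun
      by_cases h1 : x ∈ B' <;> by_cases h2 : y ∈ A' <;> simp [h1, h2, mul_comm]
    rw [e, hrep y x, List.map_map]
    congr 1
    congr 1
    refine List.map_congr_left fun R _ => ?_
    simp only [Function.comp]
    exact (e R.A R.B).symm
  · rw [Finset.sum_comm]; exact hErr

end Rectangles

/-! ### Counting fibres; the min-entropy bound for block-fixed rectangles (Lemma 6.11); heavy sets -/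

section Counting

variable {n b : ℕ} {P Q : (Fin n → Fin b → Bool) → ℝ}

/-- A fibre `{x : x_F = ξ}` of the block projection has `2^{b(n − |F|)}` elements. [cite: KothariMekaRaghavendra2017, §6.4 (proof of Lemma 6.11)] -/
theorem card_filter_blockRestrict (F : Finset (Fin n)) (ξ : (↥F × Fin b) → Bool) :
    ((univ : Finset (Fin n → Fin b → Bool)).filter (fun x => blockRestrict F x = ξ)).card =
      2 ^ (b * (n - F.card)) := by
  classical
  let e : {x : Fin n → Fin b → Bool // blockRestrict F x = ξ} ≃ (↥(Fᶜ) → Fin b → Bool) :=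
  { toFun := fun x i => x.1 i.1
    invFun := fun g => ⟨fun j => if h : j ∈ F then (fun k => ξ (⟨j, h⟩, k)) else g ⟨j, Finset.mem_compl.2 h⟩, by
        funext p
        rcases p with ⟨⟨j, hj⟩, k⟩
        simp [blockRestrict, hj]⟩
    left_inv := by
      rintro ⟨x, hx⟩
      apply Subtype.ext
      funext j
      by_cases h : j ∈ F
      · funext k
        simp only [dif_pos h]
        have := congrFun hx (⟨j, h⟩, k)
        simpa [blockRestrict] using this.symm
      · simp only [dif_neg h]
    right_inv := by
      intro g
      funext i
      have : ¬ (i.1 ∈ F) := Finset.mem_compl.1 i.2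
      simp only [dif_neg this] }
  rw [← Fintype.card_subtype, Fintype.card_congr e, Fintype.card_fun, Fintype.card_fun, Fintype.card_bool,
    Fintype.card_fin, Fintype.card_coe, Finset.card_compl, Fintype.card_fin, ← pow_mul]

/-- **The min-entropy bound for a block-fixed set (product form of Lemma 6.11):** if `2^{bn} P(x) ≤ M` for all
`x` and `A ⊆ {x_F = α_F}`, then `2^{b|F|} P(A) ≤ M`. [cite: KothariMekaRaghavendra2017, Lemma 6.11 (§6.4)] -/
theorem pow_mul_massOn_le_of_fixedOn (hP0 : ∀ x, 0 ≤ P x) {M : ℝ} (hP : ∀ x, (2 : ℝ) ^ (b * n) * P x ≤ M)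
    {A : Finset (Fin n → Fin b → Bool)} {F : Finset (Fin n)} {α : Fin n → Fin b → Bool} (hA : FixedOn A F α) :
    (2 : ℝ) ^ (b * F.card) * massOn P A ≤ M := by
  classical
  have hFn : F.card ≤ n := by simpa using F.card_le_univ
  have hsub : A ⊆ univ.filter (fun x => blockRestrict F x = blockRestrict F α) := by
    intro x hx
    simp only [mem_filter, mem_univ, true_and]
    funext p
    show x p.1.1 p.2 = α p.1.1 p.2
    rw [hA x hx p.1.1 p.1.2]
  have h1 : massOn P A ≤ (2 : ℝ) ^ (b * (n - F.card)) * (M / (2 : ℝ) ^ (b * n)) := by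
    calc massOn P A ≤ massOn P (univ.filter (fun x => blockRestrict F x = blockRestrict F α)) := massOn_mono hP0 hsub
      _ ≤ ∑ _x ∈ univ.filter (fun x => blockRestrict F x = blockRestrict F α), M / (2 : ℝ) ^ (b * n) := by
          unfold massOn
          refine sum_le_sum fun x _ => ?_
          rw [le_div_iff₀ (by positivity), mul_comm]; exact hP x
      _ = (2 : ℝ) ^ (b * (n - F.card)) * (M / (2 : ℝ) ^ (b * n)) := by
          rw [Finset.sum_const, nsmul_eq_mul, card_filter_blockRestrict]; push_cast; ring
  have e : (2 : ℝ) ^ (b * F.card) * ((2 : ℝ) ^ (b * (n - F.card)) * (M / (2 : ℝ) ^ (b * n))) = M := by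
    rw [← mul_assoc, ← pow_add, show b * F.card + b * (n - F.card) = b * n by
      rw [← Nat.mul_add]; congr 1; omega]
    field_simp
  calc (2 : ℝ) ^ (b * F.card) * massOn P A
      ≤ (2 : ℝ) ^ (b * F.card) * ((2 : ℝ) ^ (b * (n - F.card)) * (M / (2 : ℝ) ^ (b * n))) :=
        mul_le_mul_of_nonneg_left h1 (by positivity)
    _ = M := e

/-- **Product form of Lemma 6.11:** under `(2^{bn}P x)(2^{bn} Q y) ≤ T`, a rectangle `A × B` fixed on `F`
(both sides) has `P(A) Q(B) ≤ T · 2^{−2b|F|}`. [cite: KothariMekaRaghavendra2017, Lemma 6.11 (§6.4)] -/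
theorem massOn_mul_massOn_le (hP0 : ∀ x, 0 ≤ P x) (hQ0 : ∀ y, 0 ≤ Q y) (hQ1 : ∑ y, Q y = 1) {T : ℝ}
    (hT : ∀ x y, ((2 : ℝ) ^ (b * n) * P x) * ((2 : ℝ) ^ (b * n) * Q y) ≤ T)
    {A B : Finset (Fin n → Fin b → Bool)} {F : Finset (Fin n)} {α β : Fin n → Fin b → Bool}
    (hA : FixedOn A F α) (hB : FixedOn B F β) :
    ((2 : ℝ) ^ (b * F.card)) ^ 2 * (massOn P A * massOn Q B) ≤ T := by
  classical
  -- the maximal column weight `MQ ≥ 1`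
  obtain ⟨y₀, -, hy₀⟩ := Finset.exists_max_image (univ : Finset (Fin n → Fin b → Bool)) Q
    ⟨fun _ _ => false, mem_univ _⟩
  set MQ : ℝ := (2 : ℝ) ^ (b * n) * Q y₀ with hMQ
  have hMQ1 : 1 ≤ MQ := by
    -- `1 = Σ Q ≤ 2^{bn} max Q`
    have : ∑ y, Q y ≤ ∑ _y : Fin n → Fin b → Bool, Q y₀ := sum_le_sum fun y _ => hy₀ y (mem_univ _)
    rw [hQ1, Finset.sum_const, card_univ, Fintype.card_fun, Fintype.card_fun, Fintype.card_bool,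
      Fintype.card_fin, Fintype.card_fin, nsmul_eq_mul] at this
    rw [hMQ, pow_mul]
    exact_mod_cast this
  have hMQ0 : 0 < MQ := by linarith
  have hPb : ∀ x, (2 : ℝ) ^ (b * n) * P x ≤ T / MQ := by
    intro x; rw [le_div_iff₀ hMQ0]; exact hT x y₀
  have hQb : ∀ y, (2 : ℝ) ^ (b * n) * Q y ≤ MQ := fun y => by
    rw [hMQ]; exact mul_le_mul_of_nonneg_left (hy₀ y (mem_univ _)) (by positivity)
  have h1 := pow_mul_massOn_le_of_fixedOn hP0 hPb hA
  have h2 := pow_mul_massOn_le_of_fixedOn hQ0 hQb hB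
  calc ((2 : ℝ) ^ (b * F.card)) ^ 2 * (massOn P A * massOn Q B)
      = ((2 : ℝ) ^ (b * F.card) * massOn P A) * ((2 : ℝ) ^ (b * F.card) * massOn Q B) := by ring
    _ ≤ (T / MQ) * MQ := mul_le_mul h1 h2 (mul_nonneg (by positivity) (massOn_nonneg hQ0 B))
        (div_nonneg (le_trans (mul_nonneg (mul_nonneg (by positivity) (hP0 α))
          (mul_nonneg (by positivity) (hQ0 y₀))) (hT α y₀)) hMQ0.le)
    _ = T := div_mul_cancel₀ T hMQ0.ne'

/-- Not blockwise-dense off `F` means: some block set `J` disjoint from `F`, `|J| ≥ 1`, and a value `ξ` are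
HEAVY, `P(A ∩ {x_J = ξ}) > θ^{|J|} P(A)`. [cite: KothariMekaRaghavendra2017, §6.3 ("there exists S ⊆ [n] and α_S such that Pr[X_S = α_S] > q^{−0.8|S|}")] -/
theorem exists_heavy_of_not_denseOn {θ : ℝ} (hP0 : ∀ x, 0 ≤ P x) {A : Finset (Fin n → Fin b → Bool)}
    {F : Finset (Fin n)} (h : ¬ DenseOn θ P A F) :
    ∃ (J : Finset (Fin n)) (ξ : (↥J × Fin b) → Bool), Disjoint J F ∧ 1 ≤ J.card ∧
      θ ^ J.card * massOn P A < bmassOn P A J ξ := by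
  classical
  unfold DenseOn at h
  simp only [not_forall, not_le] at h
  obtain ⟨J, hJF, ξ, hlt⟩ := h
  refine ⟨J, ξ, hJF, ?_, hlt⟩
  by_contra hJ
  have hJ0 : J.card = 0 := by omega
  rw [hJ0, pow_zero, one_mul] at hlt
  have : bmassOn P A J ξ ≤ massOn P A := by
    rw [bmassOn_eq_massOn_filter]; exact massOn_mono hP0 (Finset.filter_subset _ _)
  linarith

/-- The block fibres of `B` partition its mass: `Σ_β Q(B ∩ {y_S = β}) = Q(B)`. [cite: KothariMekaRaghavendra2017, §6.3] -/
theorem sum_massOn_filter_blockRestrict (B : Finset (Fin n → Fin b → Bool)) (S : Finset (Fin n)) :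
    ∑ β : (↥S × Fin b) → Bool, massOn Q (B.filter fun y => blockRestrict S y = β) = massOn Q B := by
  classical
  unfold massOn
  rw [← Finset.sum_fiberwise B (blockRestrict S) Q]

end Counting

/-! ### The decomposition algorithm (§6.3) as an existence proof: one `Decompose` call (the while loop) -/

section Loop

variable {n b : ℕ}

/-- `2^{b|S|}` values of the `S`-blocks. [cite: KothariMekaRaghavendra2017, §6.3 ("for every β ∈ [q]^S")] -/
theorem card_blockValues (S : Finset (Fin n)) : Fintype.card ((↥S × Fin b) → Bool) = 2 ^ (b * S.card) := by
  rw [Fintype.card_fun, Fintype.card_bool, Fintype.card_prod, Fintype.card_coe, Fintype.card_fin, mul_comm]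

/-- A string of `A ∩ {x_S = ξ}` fixes `F ∪ S` when `A` fixes `F`. [cite: KothariMekaRaghavendra2017, §6.3 (invariant of XDecompose)] -/
theorem fixedOn_filter_union {A : Finset (Fin n → Fin b → Bool)} {F S : Finset (Fin n)} {α : Fin n → Fin b → Bool}
    (hA : FixedOn A F α) {ξ : (↥S × Fin b) → Bool} {x₀ : Fin n → Fin b → Bool}
    (hx₀ : x₀ ∈ A.filter fun x => blockRestrict S x = ξ) :
    FixedOn (A.filter fun x => blockRestrict S x = ξ) (F ∪ S) x₀ := by
  intro x hx j hj
  have hx' := (mem_filter.1 hx)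
  have hx₀' := (mem_filter.1 hx₀)
  rcases mem_union.1 hj with hjF | hjS
  · rw [hA x hx'.1 j hjF, hA x₀ hx₀'.1 j hjF]
  · funext k
    have e1 := congrFun hx'.2 (⟨j, hjS⟩, k)
    have e2 := congrFun hx₀'.2 (⟨j, hjS⟩, k)
    simp only [blockRestrict] at e1 e2
    rw [e1, e2]

variable {P Q : (Fin n → Fin b → Bool) → ℝ}

/-- **One heavy step of `Decompose` on the row side** (the body of the while loop when `X_{F̄}` is not
blockwise-dense): split off `A_{|S=ξ}` for a heavy `(S, ξ)`, decompose `A_{|S=ξ} × B_{|S=β}` for every `β`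
by the deeper calls, and continue with `A_{|S≠ξ} × B` (or stop if its mass fell below `δ·M₀`). The error
bookkeeping is the potential `K·(ln(M/(δM₀)) + 1)`: the deeper calls cost `K θ^{|S|} < K·m₁/M ≤ K ln(M/M')`.
[cite: KothariMekaRaghavendra2017, §6.3 (Decompose, steps 3–4) with Lemmas 6.6, 6.10, 6.12–6.15 (§6.4)] -/
theorem hasRectDecomp_step {θ δ K M₀ : ℝ} (hθ0 : 0 < θ) (hθ1 : θ ≤ 1) (hδ0 : 0 < δ) (hK : 0 ≤ K)
    (hM₀ : 0 < M₀) {d : ℕ} (hP0 : ∀ x, 0 ≤ P x) (hQ0 : ∀ y, 0 ≤ Q y) {F : Finset (Fin n)} (hFd : F.card < d)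
    (IH : ∀ (A' B' : Finset (Fin n → Fin b → Bool)) (S : Finset (Fin n)) (α' β' : Fin n → Fin b → Bool),
      Disjoint S F → 1 ≤ S.card → FixedOn A' (F ∪ S) α' → FixedOn B' (F ∪ S) β' →
      HasRectDecomp θ d P Q A' B' (((d - (F ∪ S).card : ℕ) : ℝ) * δ * (massOn P A' * massOn Q B') +
        K * (θ / 2 ^ b) ^ S.card))
    {A B : Finset (Fin n → Fin b → Bool)} {α β : Fin n → Fin b → Bool} (hA : FixedOn A F α) (hB : FixedOn B F β)
    (hM : δ * M₀ ≤ massOn P A * massOn Q B) (hAd : ¬ DenseOn θ P A F)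
    (ih : ∀ (A₂ B₂ : Finset (Fin n → Fin b → Bool)) (α₂ β₂ : Fin n → Fin b → Bool),
      A₂.card + B₂.card < A.card + B.card → FixedOn A₂ F α₂ → FixedOn B₂ F β₂ →
      δ * M₀ ≤ massOn P A₂ * massOn Q B₂ →
      HasRectDecomp θ d P Q A₂ B₂ (δ * M₀ + ((d - F.card - 1 : ℕ) : ℝ) * δ * (massOn P A₂ * massOn Q B₂) +
        K * (Real.log (massOn P A₂ * massOn Q B₂ / (δ * M₀)) + 1))) :
    HasRectDecomp θ d P Q A B (δ * M₀ + ((d - F.card - 1 : ℕ) : ℝ) * δ * (massOn P A * massOn Q B) +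
      K * (Real.log (massOn P A * massOn Q B / (δ * M₀)) + 1)) := by
  classical
  set M : ℝ := massOn P A * massOn Q B with hMdef
  have hMpos : 0 < M := lt_of_lt_of_le (mul_pos hδ0 hM₀) hM
  have hPA0 : 0 ≤ massOn P A := massOn_nonneg hP0 A
  have hQB0 : 0 ≤ massOn Q B := massOn_nonneg hQ0 B
  have hQBpos : 0 < massOn Q B := by
    rcases hQB0.eq_or_lt with h | h
    · rw [hMdef, ← h, mul_zero] at hMpos; exact absurd hMpos (lt_irrefl 0)
    · exact h
  have hlog0 : 0 ≤ Real.log (M / (δ * M₀)) :=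
    Real.log_nonneg (by rw [le_div_iff₀ (mul_pos hδ0 hM₀)]; linarith)
  set c : ℝ := ((d - F.card - 1 : ℕ) : ℝ) with hc
  have hc0 : 0 ≤ c := by positivity
  -- a heavy block set on the row side
  obtain ⟨S, ξ, hSF, hS1, hheavy⟩ := exists_heavy_of_not_denseOn hP0 hAd
  set A₁ := A.filter (fun x => blockRestrict S x = ξ) with hA₁
  set A₂ := A.filter (fun x => ¬ blockRestrict S x = ξ) with hA₂
  have hsplit : massOn P A₁ + massOn P A₂ = massOn P A := massOn_filter_add A _
  have hA₁m : bmassOn P A S ξ = massOn P A₁ := rfl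
  set m₁ : ℝ := massOn P A₁ * massOn Q B with hm₁
  set M' : ℝ := massOn P A₂ * massOn Q B with hM'def
  have hMsplit : m₁ + M' = M := by rw [hm₁, hM'def, hMdef, ← hsplit]; ring
  have hθS : θ ^ S.card * M < m₁ := by
    rw [hMdef, hm₁, ← mul_assoc]
    exact mul_lt_mul_of_pos_right (by rw [← hA₁m]; exact hheavy) hQBpos
  have hPA₁pos : 0 < massOn P A₁ := by
    have : θ ^ S.card * massOn P A < massOn P A₁ := by rw [← hA₁m]; exact hheavy
    exact lt_of_le_of_lt (by positivity) this
  have hA₁ne : A₁.Nonempty := by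
    by_contra hne
    rw [Finset.not_nonempty_iff_eq_empty] at hne
    rw [hne] at hPA₁pos; simp [massOn] at hPA₁pos
  obtain ⟨x₀, hx₀⟩ := hA₁ne
  have hA₁fix : FixedOn A₁ (F ∪ S) x₀ := fixedOn_filter_union hA hx₀
  have hm₁M : m₁ ≤ M := by
    have : 0 ≤ M' := mul_nonneg (massOn_nonneg hP0 _) hQB0
    linarith
  have hm₁0 : 0 ≤ m₁ := mul_nonneg (massOn_nonneg hP0 _) hQB0
  -- the deeper calls on `A₁ × B_{|S=β}`
  have hFS : (F ∪ S).card = F.card + S.card := by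
    rw [Finset.card_union_of_disjoint hSF.symm]
  have hcS : ((d - (F ∪ S).card : ℕ) : ℝ) ≤ c := by
    rw [hc, hFS]; exact_mod_cast (by omega : d - (F.card + S.card) ≤ d - F.card - 1)
  set E : ((↥S × Fin b) → Bool) → ℝ := fun β' =>
    c * δ * (massOn P A₁ * massOn Q (B.filter fun y => blockRestrict S y = β')) + K * (θ / 2 ^ b) ^ S.card
    with hE
  have hfib : ∀ β', HasRectDecomp θ d P Q A₁ (B.filter fun y => blockRestrict S y = β') (E β') := by
    intro β'
    by_cases hne : (B.filter fun y => blockRestrict S y = β').Nonempty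
    · obtain ⟨y₀, hy₀⟩ := hne
      have hB₁fix : FixedOn (B.filter fun y => blockRestrict S y = β') (F ∪ S) y₀ := fixedOn_filter_union hB hy₀
      refine (IH A₁ _ S x₀ y₀ hSF hS1 hA₁fix hB₁fix).mono ?_
      rw [hE]
      have : 0 ≤ δ * (massOn P A₁ * massOn Q (B.filter fun y => blockRestrict S y = β')) :=
        mul_nonneg hδ0.le (mul_nonneg (massOn_nonneg hP0 _) (massOn_nonneg hQ0 _))
      nlinarith
    · rw [Finset.not_nonempty_iff_eq_empty] at hne
      rw [hne]
      refine (hasRectDecomp_error hP0 hQ0 θ d A₁ ∅).mono ?_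
      have h0 : massOn Q (∅ : Finset (Fin n → Fin b → Bool)) = 0 := by simp [massOn]
      rw [h0, mul_zero, hE]
      simp only
      have h1 : 0 ≤ c * δ * (massOn P A₁ * massOn Q (B.filter fun y => blockRestrict S y = β')) :=
        mul_nonneg (mul_nonneg hc0 hδ0.le) (mul_nonneg (massOn_nonneg hP0 _) (massOn_nonneg hQ0 _))
      exact add_nonneg h1 (mul_nonneg hK (pow_nonneg (div_nonneg hθ0.le (by positivity)) _))
  have h₁ : HasRectDecomp θ d P Q A₁ B (c * δ * m₁ + K * θ ^ S.card) := by
    have h := hasRectDecomp_fibres_univ S E hfib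
    refine h.mono (le_of_eq ?_)
    rw [hE]
    simp only
    rw [Finset.sum_add_distrib, Finset.sum_const, card_univ, card_blockValues, nsmul_eq_mul, ← Finset.mul_sum,
      ← Finset.mul_sum, sum_massOn_filter_blockRestrict]
    push_cast
    rw [hm₁, div_pow, ← pow_mul]
    field_simp
  -- the remainder `A₂ × B`
  have hcardA : A₁.card + A₂.card = A.card := Finset.card_filter_add_card_filter_not (s := A) _
  have hA₂card : A₂.card + B.card < A.card + B.card := by
    have : 0 < A₁.card := Finset.card_pos.2 ⟨x₀, hx₀⟩
    omega
  have hA₂fix : FixedOn A₂ F α := fun x hx => hA x (mem_filter.1 hx).1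
  by_cases hM' : δ * M₀ ≤ M'
  · -- continue the loop
    have hM'pos : 0 < M' := lt_of_lt_of_le (mul_pos hδ0 hM₀) hM'
    have h₂ := ih A₂ B α β hA₂card hA₂fix hB hM'
    have h := h₁.union_filter (fun x => blockRestrict S x = ξ) h₂
    refine h.mono ?_
    -- `θ^{|S|} + ln(M'/(δM₀)) ≤ ln(M/(δM₀))`
    have hkey : θ ^ S.card + Real.log (M' / (δ * M₀)) ≤ Real.log (M / (δ * M₀)) := by
      have h1 : θ ^ S.card ≤ 1 - (M / M')⁻¹ := by
        rw [inv_div]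
        have e : 1 - M' / M = m₁ / M := by
          field_simp
          linarith [hMsplit]
        rw [e, le_div_iff₀ hMpos]
        exact hθS.le
      have h2 : 1 - (M / M')⁻¹ ≤ Real.log (M / M') := Real.one_sub_inv_le_log_of_pos (div_pos hMpos hM'pos)
      have h3 : Real.log (M / M') + Real.log (M' / (δ * M₀)) = Real.log (M / (δ * M₀)) := by
        rw [← Real.log_mul (div_pos hMpos hM'pos).ne' (div_pos hM'pos (mul_pos hδ0 hM₀)).ne']
        congr 1
        field_simp
      linarith
    have e : c * δ * m₁ + K * θ ^ S.card + (δ * M₀ + c * δ * M' + K * (Real.log (M' / (δ * M₀)) + 1)) =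
        δ * M₀ + c * δ * M + K * (θ ^ S.card + Real.log (M' / (δ * M₀)) + 1) := by
      rw [← hMsplit]; ring
    rw [e]
    have := mul_le_mul_of_nonneg_left hkey hK
    nlinarith
  · -- the remainder goes to `Error_a`
    have h₂ := hasRectDecomp_error hP0 hQ0 θ d A₂ B
    have h := h₁.union_filter (fun x => blockRestrict S x = ξ) h₂
    refine h.mono ?_
    have hθS1 : θ ^ S.card ≤ 1 := pow_le_one₀ hθ0.le hθ1
    have : M' < δ * M₀ := not_le.1 hM'
    have hKθ : K * θ ^ S.card ≤ K * (Real.log (M / (δ * M₀)) + 1) :=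
      mul_le_mul_of_nonneg_left (by linarith) hK
    have hcm : c * δ * m₁ ≤ c * δ * M := mul_le_mul_of_nonneg_left hm₁M (by positivity)
    rw [← hM'def]
    linarith

end Loop

section LoopInduction

variable {n b : ℕ}

/-- The deeper-call hypothesis of the loop, for the pair `(P, Q)` at fixed blocks `F`. [cite: KothariMekaRaghavendra2017, §6.3] -/
def DeepIH (θ δ K : ℝ) (d : ℕ) (P Q : (Fin n → Fin b → Bool) → ℝ) (F : Finset (Fin n)) : Prop :=
  ∀ (A' B' : Finset (Fin n → Fin b → Bool)) (S : Finset (Fin n)) (α' β' : Fin n → Fin b → Bool),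
    Disjoint S F → 1 ≤ S.card → FixedOn A' (F ∪ S) α' → FixedOn B' (F ∪ S) β' →
    HasRectDecomp θ d P Q A' B' (((d - (F ∪ S).card : ℕ) : ℝ) * δ * (massOn P A' * massOn Q B') +
      K * (θ / 2 ^ b) ^ S.card)

/-- The loop claim for the pair `(P, Q)` at `(A, B)`. [cite: KothariMekaRaghavendra2017, §6.3] -/
def LoopClaim (θ δ K M₀ : ℝ) (d : ℕ) (P Q : (Fin n → Fin b → Bool) → ℝ) (F : Finset (Fin n))
    (A B : Finset (Fin n → Fin b → Bool)) : Prop :=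
  ∀ (α β : Fin n → Fin b → Bool), FixedOn A F α → FixedOn B F β → δ * M₀ ≤ massOn P A * massOn Q B →
    HasRectDecomp θ d P Q A B (δ * M₀ + ((d - F.card - 1 : ℕ) : ℝ) * δ * (massOn P A * massOn Q B) +
      K * (Real.log (massOn P A * massOn Q B / (δ * M₀)) + 1))

/-- The deeper-call hypothesis is symmetric under swapping rows and columns. [cite: KothariMekaRaghavendra2017, §6.3 (XDecompose / YDecompose)] -/
theorem DeepIH.swap {θ δ K : ℝ} {d : ℕ} {P Q : (Fin n → Fin b → Bool) → ℝ} {F : Finset (Fin n)}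
    (h : DeepIH θ δ K d P Q F) : DeepIH θ δ K d Q P F := by
  intro A' B' S α' β' hSF hS1 hA' hB'
  have := (h B' A' S β' α' hSF hS1 hB' hA').swap
  rwa [mul_comm (massOn P B') (massOn Q A')] at this

variable {P Q : (Fin n → Fin b → Bool) → ℝ}

/-- One `Decompose` call, half: the claim for `(P,Q)` at `(A,B)` from the claims (both orders) at all smaller
rectangles. [cite: KothariMekaRaghavendra2017, §6.3 (Decompose)] -/
theorem loopClaim_of_smaller {θ δ K M₀ : ℝ} (hθ0 : 0 < θ) (hθ1 : θ ≤ 1) (hδ0 : 0 < δ) (hK : 0 ≤ K)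
    (hM₀ : 0 < M₀) {d : ℕ} (hP0 : ∀ x, 0 ≤ P x) (hQ0 : ∀ y, 0 ≤ Q y) {F : Finset (Fin n)} (hFd : F.card < d)
    (IH : DeepIH θ δ K d P Q F) (IH' : DeepIH θ δ K d Q P F) {A B : Finset (Fin n → Fin b → Bool)}
    (ih : ∀ A₂ B₂ : Finset (Fin n → Fin b → Bool), A₂.card + B₂.card < A.card + B.card →
      LoopClaim θ δ K M₀ d P Q F A₂ B₂)
    (ih' : ∀ A₂ B₂ : Finset (Fin n → Fin b → Bool), A₂.card + B₂.card < B.card + A.card →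
      LoopClaim θ δ K M₀ d Q P F A₂ B₂) :
    LoopClaim θ δ K M₀ d P Q F A B := by
  intro α β hA hB hM
  have hMpos : 0 < massOn P A * massOn Q B := lt_of_lt_of_le (mul_pos hδ0 hM₀) hM
  have hPApos : 0 < massOn P A := by
    rcases (massOn_nonneg hP0 A).eq_or_lt with h | h
    · rw [← h, zero_mul] at hMpos; exact absurd hMpos (lt_irrefl 0)
    · exact h
  have hQBpos : 0 < massOn Q B := by
    rcases (massOn_nonneg hQ0 B).eq_or_lt with h | h
    · rw [← h, mul_zero] at hMpos; exact absurd hMpos (lt_irrefl 0)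
    · exact h
  by_cases hd : DenseOn θ P A F ∧ DenseOn θ Q B F
  · -- a good leaf
    have hgood : (⟨A, B, F, α, β⟩ : Rect n b).Good θ d P Q := ⟨hA, hB, hd.1, hd.2, hFd.le, hPApos, hQBpos⟩
    refine (hasRectDecomp_good hgood).mono ?_
    have hlog0 : 0 ≤ Real.log (massOn P A * massOn Q B / (δ * M₀)) :=
      Real.log_nonneg (by rw [le_div_iff₀ (mul_pos hδ0 hM₀)]; linarith)
    have : 0 ≤ ((d - F.card - 1 : ℕ) : ℝ) * δ * (massOn P A * massOn Q B) := by positivity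
    nlinarith [mul_pos hδ0 hM₀]
  · rcases not_and_or.1 hd with hAd | hBd
    · exact hasRectDecomp_step hθ0 hθ1 hδ0 hK hM₀ hP0 hQ0 hFd IH hA hB hM hAd
        (fun A₂ B₂ α₂ β₂ hcard hA₂ hB₂ hM₂ => ih A₂ B₂ hcard α₂ β₂ hA₂ hB₂ hM₂)
    · have hM' : δ * M₀ ≤ massOn Q B * massOn P A := by rw [mul_comm (massOn Q B)]; exact hM
      have h := hasRectDecomp_step hθ0 hθ1 hδ0 hK hM₀ hQ0 hP0 hFd IH' hB hA hM' hBd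
        (fun A₂ B₂ α₂ β₂ hcard hA₂ hB₂ hM₂ => ih' A₂ B₂ hcard α₂ β₂ hA₂ hB₂ hM₂)
      have h' := h.swap
      rwa [mul_comm (massOn Q B) (massOn P A)] at h'

/-- **One `Decompose` call (the while loop of §6.3), as an existence statement:** for `(A,B)` fixed on `F`
(`|F| < d`) with `P(A)Q(B) ≥ δ M₀`, a decomposition with error
`≤ δM₀ + (d−|F|−1) δ P(A)Q(B) + K (ln(P(A)Q(B)/(δM₀)) + 1)`, given the deeper calls. By strong induction
on `|A| + |B|`, both orders at once. [cite: KothariMekaRaghavendra2017, §6.3 (Decompose) with §6.4 (Lemmas 6.6, 6.10, 6.13–6.15)] -/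
theorem loopClaim_all {θ δ K M₀ : ℝ} (hθ0 : 0 < θ) (hθ1 : θ ≤ 1) (hδ0 : 0 < δ) (hK : 0 ≤ K)
    (hM₀ : 0 < M₀) {d : ℕ} (hP0 : ∀ x, 0 ≤ P x) (hQ0 : ∀ y, 0 ≤ Q y) {F : Finset (Fin n)} (hFd : F.card < d)
    (IH : DeepIH θ δ K d P Q F) :
    ∀ (m : ℕ) (A B : Finset (Fin n → Fin b → Bool)), A.card + B.card = m →
      LoopClaim θ δ K M₀ d P Q F A B ∧ LoopClaim θ δ K M₀ d Q P F A B := by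
  have IH' := IH.swap
  intro m
  induction m using Nat.strong_induction_on with
  | _ m ihm =>
    intro A B hm
    constructor
    · exact loopClaim_of_smaller hθ0 hθ1 hδ0 hK hM₀ hP0 hQ0 hFd IH IH'
        (fun A₂ B₂ hlt => (ihm _ (hm ▸ hlt) A₂ B₂ rfl).1)
        (fun A₂ B₂ hlt => (ihm _ (by omega) A₂ B₂ rfl).2)
    · exact loopClaim_of_smaller hθ0 hθ1 hδ0 hK hM₀ hQ0 hP0 hFd IH' IH
        (fun A₂ B₂ hlt => (ihm _ (hm ▸ hlt) A₂ B₂ rfl).2)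
        (fun A₂ B₂ hlt => (ihm _ (by omega) A₂ B₂ rfl).1)

end LoopInduction

/-! ### The depth recursion (`F ↦ F ∪ S`) and the error bound of Theorem 6.4 (product case) -/

section Depth

variable {n b : ℕ} {P Q : (Fin n → Fin b → Bool) → ℝ}

/-- **Theorem 6.4 (product case) at a node `(A × B, F)` of the decomposition tree:** with `σ = 2^{−b/20}`,
`θ = σ^{16} = q^{−0.8}`, `0 < δ ≤ 1`, `L ≥ ln(1/δ) + 1`, and `(2^{bn}P)(2^{bn}Q) ≤ T` pointwise, every rectangle
`A × B` fixed on `F` decomposes into good rectangles with error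
`≤ (d − |F|) δ P(A)Q(B) + T σ^{4d} σ^{36|F|} L^{d−|F|}` (for `|F| ≥ d` everything is error, bounded by
Lemma 6.11; for `|F| < d` one `Decompose` call). [cite: KothariMekaRaghavendra2017, Thm 6.4 (§6.2) with its proof (§6.3–6.4)] -/
theorem hasRectDecomp_depth {σ δ T L : ℝ} (hσ0 : 0 < σ) (hσ1 : σ ≤ 1) (hσb : σ ^ 20 * 2 ^ b = 1)
    (hδ0 : 0 < δ) (hδ1 : δ ≤ 1) (hL : Real.log (1 / δ) + 1 ≤ L) {d : ℕ} (hP0 : ∀ x, 0 ≤ P x)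
    (hQ0 : ∀ y, 0 ≤ Q y) (hQ1 : ∑ y, Q y = 1)
    (hT : ∀ x y, ((2 : ℝ) ^ (b * n) * P x) * ((2 : ℝ) ^ (b * n) * Q y) ≤ T) :
    ∀ (k : ℕ) (F : Finset (Fin n)), d - F.card = k → ∀ (A B : Finset (Fin n → Fin b → Bool))
      (α β : Fin n → Fin b → Bool), FixedOn A F α → FixedOn B F β →
      HasRectDecomp (σ ^ 16) d P Q A B (((d - F.card : ℕ) : ℝ) * δ * (massOn P A * massOn Q B) +
        T * σ ^ (4 * d) * (σ ^ 36) ^ F.card * L ^ (d - F.card)) := by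
  have hT1 : 0 ≤ T := le_trans (mul_nonneg (mul_nonneg (by positivity) (hP0 _)) (mul_nonneg (by positivity) (hQ0 _)))
    (hT (fun _ _ => false) (fun _ _ => false))
  have hL1 : 1 ≤ L := le_trans (by
    have : 0 ≤ Real.log (1 / δ) := Real.log_nonneg (by rw [le_div_iff₀ hδ0]; linarith)
    linarith) hL
  have hθ0 : 0 < σ ^ 16 := pow_pos hσ0 16
  have hθ1 : σ ^ 16 ≤ 1 := pow_le_one₀ hσ0.le hσ1
  have hν : σ ^ 16 / 2 ^ b = σ ^ 36 := by
    rw [div_eq_iff (by positivity)]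
    calc σ ^ 16 = σ ^ 16 * (σ ^ 20 * 2 ^ b) := by rw [hσb, mul_one]
      _ = σ ^ 36 * 2 ^ b := by ring
  -- the global bound (Lemma 6.11, product form): `P(A)Q(B) ≤ T σ^{40|F|}`
  have hglob : ∀ (F : Finset (Fin n)) (A B : Finset (Fin n → Fin b → Bool)) (α β : Fin n → Fin b → Bool),
      FixedOn A F α → FixedOn B F β → massOn P A * massOn Q B ≤ T * (σ ^ 40) ^ F.card := by
    intro F A B α β hA hB
    have h := massOn_mul_massOn_le hP0 hQ0 hQ1 hT hA hB
    have e : ((2 : ℝ) ^ (b * F.card)) ^ 2 * (σ ^ 40) ^ F.card = 1 := by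
      rw [show ((2 : ℝ) ^ (b * F.card)) ^ 2 * (σ ^ 40) ^ F.card = (σ ^ 20 * 2 ^ b) ^ (2 * F.card) by ring,
        hσb, one_pow]
    have hpos : 0 < ((2 : ℝ) ^ (b * F.card)) ^ 2 := by positivity
    calc massOn P A * massOn Q B = (((2 : ℝ) ^ (b * F.card)) ^ 2 * (massOn P A * massOn Q B)) *
          (σ ^ 40) ^ F.card := by
          calc massOn P A * massOn Q B
              = (massOn P A * massOn Q B) * (((2 : ℝ) ^ (b * F.card)) ^ 2 * (σ ^ 40) ^ F.card) := by
                rw [e, mul_one]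
            _ = _ := by ring
      _ ≤ T * (σ ^ 40) ^ F.card := mul_le_mul_of_nonneg_right h (by positivity)
  intro k
  induction k using Nat.strong_induction_on with
  | _ k ihk =>
    intro F hk A B α β hA hB
    by_cases hFd : d ≤ F.card
    · -- `|F| ≥ d`: everything is error (a bad leaf)
      refine (hasRectDecomp_error hP0 hQ0 _ d A B).mono ?_
      have h1 := hglob F A B α β hA hB
      have h2 : T * (σ ^ 40) ^ F.card ≤ T * σ ^ (4 * d) * (σ ^ 36) ^ F.card * L ^ (d - F.card) := by
        rw [show d - F.card = 0 by omega, pow_zero, mul_one, mul_assoc]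
        refine mul_le_mul_of_nonneg_left ?_ hT1
        rw [← pow_mul, ← pow_mul, ← pow_add]
        exact pow_le_pow_of_le_one hσ0.le hσ1 (by omega)
      have h3 : 0 ≤ ((d - F.card : ℕ) : ℝ) * δ * (massOn P A * massOn Q B) :=
        mul_nonneg (by positivity) (mul_nonneg (massOn_nonneg hP0 A) (massOn_nonneg hQ0 B))
      linarith
    · -- `|F| < d`: one Decompose call
      have hFd' : F.card < d := not_le.1 hFd
      set K : ℝ := T * σ ^ (4 * d) * (σ ^ 36) ^ F.card * L ^ (d - F.card - 1) with hKdef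
      have hK0 : 0 ≤ K := by positivity
      -- the deeper calls
      have hDeep : DeepIH (σ ^ 16) δ K d P Q F := by
        intro A' B' S α' β' hSF hS1 hA' hB'
        have hFS : (F ∪ S).card = F.card + S.card := by rw [Finset.card_union_of_disjoint hSF.symm]
        have hk' : d - (F ∪ S).card < k := by rw [hFS]; omega
        refine (ihk _ hk' (F ∪ S) rfl A' B' α' β' hA' hB').mono (add_le_add le_rfl ?_)
        rw [hν, hKdef, hFS, pow_add]
        have hLle : L ^ (d - (F.card + S.card)) ≤ L ^ (d - F.card - 1) :=
          pow_le_pow_right₀ hL1 (by omega)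
        calc T * σ ^ (4 * d) * ((σ ^ 36) ^ F.card * (σ ^ 36) ^ S.card) * L ^ (d - (F.card + S.card))
            ≤ T * σ ^ (4 * d) * ((σ ^ 36) ^ F.card * (σ ^ 36) ^ S.card) * L ^ (d - F.card - 1) :=
              mul_le_mul_of_nonneg_left hLle (by positivity)
          _ = T * σ ^ (4 * d) * (σ ^ 36) ^ F.card * L ^ (d - F.card - 1) * (σ ^ 36) ^ S.card := by ring
      -- the call itself
      rcases (mul_nonneg (massOn_nonneg hP0 A) (massOn_nonneg hQ0 B)).eq_or_lt with hM0 | hMpos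
      · -- zero mass: the error is the (zero) restriction itself
        refine (hasRectDecomp_error hP0 hQ0 _ d A B).mono ?_
        rw [← hM0, mul_zero, zero_add]
        positivity
      · have hloop := (loopClaim_all hθ0 hθ1 hδ0 hK0 hMpos hP0 hQ0 hFd' hDeep (A.card + B.card) A B rfl).1
          α β hA hB (by nlinarith)
        refine hloop.mono ?_
        have e1 : massOn P A * massOn Q B / (δ * (massOn P A * massOn Q B)) = 1 / δ := by
          rw [mul_comm δ, ← div_div, div_self hMpos.ne']
        rw [e1]
        have e2 : ((d - F.card : ℕ) : ℝ) = ((d - F.card - 1 : ℕ) : ℝ) + 1 := by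
          rw [show d - F.card = (d - F.card - 1) + 1 by omega]; push_cast; ring
        have e3 : L ^ (d - F.card) = L ^ (d - F.card - 1) * L := by
          rw [← pow_succ]; congr 1; omega
        rw [e2, e3]
        have hKL : K * (Real.log (1 / δ) + 1) ≤ T * σ ^ (4 * d) * (σ ^ 36) ^ F.card * (L ^ (d - F.card - 1) * L) := by
          rw [hKdef]
          calc T * σ ^ (4 * d) * (σ ^ 36) ^ F.card * L ^ (d - F.card - 1) * (Real.log (1 / δ) + 1)
              ≤ T * σ ^ (4 * d) * (σ ^ 36) ^ F.card * L ^ (d - F.card - 1) * L :=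
                mul_le_mul_of_nonneg_left hL (by positivity)
            _ = _ := by ring
        nlinarith [mul_nonneg hδ0.le hMpos.le]

end Depth

/-! ### From a rectangular decomposition of `[q]^n × [q]^n` to `HasAlignedDecomposition` -/

section Assembly

variable {n b : ℕ} {P Q : (Fin n → Fin b → Bool) → ℝ}

/-- `Σ_{i < |L|} f(L[i]) = Σ_{R ∈ L} f(R)`. [folklore] [cite: KothariMekaRaghavendra2017, §6.2 (indexing the leaves)] -/
theorem sum_fin_getElem_eq_sum_map {ι : Type*} (f : ι → ℝ) :
    ∀ L : List ι, ∑ i : Fin L.length, f (L[(i : ℕ)]) = (L.map f).sum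
  | [] => by simp
  | a :: L => by
    rw [List.map_cons, List.sum_cons, ← sum_fin_getElem_eq_sum_map f L]
    exact Fin.sum_univ_succ _

/-- Weakening the error weight bound of an aligned decomposition. [cite: KothariMekaRaghavendra2017, Thm 2.11] -/
theorem HasAlignedDecomposition.mono_err {θ₁ θ₂ : ℝ} {d : ℕ} {δ δ' : ℝ} (h : HasAlignedDecomposition θ₁ θ₂ d δ P Q)
    (hδ : δ ≤ δ') : HasAlignedDecomposition θ₁ θ₂ d δ' P Q := by
  obtain ⟨N, lam, Pc, Qc, I, α, β, lamErr, E, h1, h2, h3, h4, hrest⟩ := h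
  exact ⟨N, lam, Pc, Qc, I, α, β, lamErr, E, h1, h2, h3, h4.trans hδ, hrest⟩

/-- The normalised restriction `P|_A / P(A)` as a vector on all strings. [cite: KothariMekaRaghavendra2017, §6 ("μ|S")] -/
def condOn (P : (Fin n → Fin b → Bool) → ℝ) (A : Finset (Fin n → Fin b → Bool)) :
    (Fin n → Fin b → Bool) → ℝ :=
  fun x => if x ∈ A then P x / massOn P A else 0

/-- `P|_A / P(A)` is a probability vector when `P(A) > 0`. [cite: KothariMekaRaghavendra2017, §6] -/
theorem sum_condOn {A : Finset (Fin n → Fin b → Bool)} (hA : 0 < massOn P A) : ∑ x, condOn P A x = 1 := by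
  classical
  unfold condOn
  rw [Finset.sum_ite_mem, Finset.univ_inter, ← Finset.sum_div]
  exact div_self hA.ne'

/-- Block marginals of `P|_A / P(A)`. [cite: KothariMekaRaghavendra2017, §6.1] -/
theorem blockMass_condOn (A : Finset (Fin n → Fin b → Bool)) (S : Finset (Fin n)) (ξ : (↥S × Fin b) → Bool) :
    blockMass (condOn P A) S ξ = bmassOn P A S ξ / massOn P A := by
  classical
  unfold blockMass condOn bmassOn
  rw [Finset.sum_filter, Finset.sum_filter, Finset.sum_div]
  rw [← Finset.sum_subset (Finset.subset_univ A) (fun x _ hx => by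
    show (if blockRestrict S x = ξ then (if x ∈ A then P x / massOn P A else 0) else 0) = 0
    rw [if_neg hx]; split_ifs <;> rfl)]
  refine sum_congr rfl fun x hx => ?_
  by_cases h : blockRestrict S x = ξ
  · rw [if_pos h, if_pos h, if_pos hx]
  · rw [if_neg h, if_neg h, zero_div]

/-- **From the rectangle decomposition to Theorem 2.11's conclusion:** normalising the good rectangles of a
`HasRectDecomp` of the whole square gives a `HasAlignedDecomposition θ θ d E P Q`.
[cite: KothariMekaRaghavendra2017, "Proof of Theorem 2.10" (§6.2)] -/
theorem hasAlignedDecomposition_of_hasRectDecomp {θ : ℝ} {d : ℕ} {E : ℝ} (hP0 : ∀ x, 0 ≤ P x)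
    (hP1 : ∑ x, P x = 1) (hQ0 : ∀ y, 0 ≤ Q y) (hQ1 : ∑ y, Q y = 1)
    (h : HasRectDecomp θ d P Q univ univ E) : HasAlignedDecomposition θ θ d E P Q := by
  classical
  obtain ⟨L, Err, hL, hErr0, hrep, hErr⟩ := h
  have hgood : ∀ i : Fin L.length, (L[(i : ℕ)]).Good θ d P Q := fun i => hL _ (List.getElem_mem _)
  set lamErr : ℝ := ∑ x, ∑ y, Err x y with hlamErr
  have hlamErr0 : 0 ≤ lamErr := sum_nonneg fun x _ => sum_nonneg fun y _ => hErr0 x y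
  -- the error distribution
  set Ed : (Fin n → Fin b → Bool) → (Fin n → Fin b → Bool) → ℝ :=
    fun x y => if lamErr = 0 then P x * Q y else Err x y / lamErr with hEd
  have hEd0 : ∀ x y, 0 ≤ Ed x y := by
    intro x y; rw [hEd]; simp only
    split_ifs
    · exact mul_nonneg (hP0 x) (hQ0 y)
    · exact div_nonneg (hErr0 x y) hlamErr0
  have hEd1 : ∑ x, ∑ y, Ed x y = 1 := by
    rw [hEd]; simp only
    split_ifs with h0
    · rw [← Finset.sum_mul_sum, hP1, hQ1, mul_one]
    · have : ∑ x, ∑ y, Err x y / lamErr = (∑ x, ∑ y, Err x y) / lamErr := by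
        rw [Finset.sum_div]; exact sum_congr rfl fun x _ => by rw [Finset.sum_div]
      rw [this, ← hlamErr, div_self h0]
  have hEdmul : ∀ x y, lamErr * Ed x y = Err x y := by
    intro x y; rw [hEd]; simp only
    split_ifs with h0
    · -- `lamErr = 0` forces `Err ≡ 0`
      have hx : ∑ y', Err x y' = 0 := by
        have := (Finset.sum_eq_zero_iff_of_nonneg (fun x' _ => sum_nonneg fun y' _ => hErr0 x' y')).1
          (hlamErr ▸ h0 :  ∑ x', ∑ y', Err x' y' = 0) x (mem_univ _)
        exact this
      have hxy : Err x y = 0 := (Finset.sum_eq_zero_iff_of_nonneg (fun y' _ => hErr0 x y')).1 hx y (mem_univ _)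
      rw [h0, zero_mul, hxy]
    · exact mul_div_cancel₀ _ h0
  refine ⟨L.length, fun i => massOn P (L[(i : ℕ)]).A * massOn Q (L[(i : ℕ)]).B,
    fun i => condOn P (L[(i : ℕ)]).A, fun i => condOn Q (L[(i : ℕ)]).B, fun i => (L[(i : ℕ)]).F,
    fun i => (L[(i : ℕ)]).α, fun i => (L[(i : ℕ)]).β, lamErr, Ed,
    fun i => mul_nonneg (massOn_nonneg hP0 _) (massOn_nonneg hQ0 _), hlamErr0, ?_, hErr,
    fun i x => ?_, fun i => sum_condOn (hgood i).2.2.2.2.2.1, fun i y => ?_, fun i => sum_condOn (hgood i).2.2.2.2.2.2,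
    fun i => (hgood i).2.2.2.2.1, fun i x hx => ?_, fun i y hy => ?_, fun i S hS ξ => ?_, fun i S hS ζ => ?_,
    hEd0, hEd1, fun x y => ?_⟩
  · -- total weight: sum the representation identity over all `(x, y)`
    have hid := fun x y => hrep x y
    have hsum : ∑ x, ∑ y, rectFun P Q univ univ x y =
        ∑ x, ∑ y, ((L.map fun R => rectFun P Q R.A R.B x y).sum + Err x y) :=
      sum_congr rfl fun x _ => sum_congr rfl fun y _ => hid x y
    rw [sum_rectFun] at hsum
    simp only [massOn, Finset.sum_add_distrib] at hsum
    rw [hP1, hQ1, mul_one] at hsum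
    rw [hlamErr, hsum]
    congr 1
    rw [sum_fin_getElem_eq_sum_map (fun R : Rect n b => massOn P R.A * massOn Q R.B) L]
    -- `Σ_x Σ_y Σ_{R∈L} rectFun R x y = Σ_{R∈L} P(R.A) Q(R.B)`
    have key : ∀ (L' : List (Rect n b)), (L'.map fun R => massOn P R.A * massOn Q R.B).sum =
        ∑ x, ∑ y, (L'.map fun R => rectFun P Q R.A R.B x y).sum := by
      intro L'
      induction L' with
      | nil => simp
      | cons R L' ih =>
        simp only [List.map_cons, List.sum_cons]
        rw [ih, ← sum_rectFun R.A R.B, ← Finset.sum_add_distrib]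
        exact sum_congr rfl fun x _ => by rw [← Finset.sum_add_distrib]
    simp only [massOn] at key ⊢
    exact key L
  · simp only [condOn]; split_ifs
    · exact div_nonneg (hP0 x) (massOn_nonneg hP0 _)
    · exact le_rfl
  · simp only [condOn]; split_ifs
    · exact div_nonneg (hQ0 y) (massOn_nonneg hQ0 _)
    · exact le_rfl
  · have hxA : x ∈ (L[(i : ℕ)]).A := by
      by_contra hx'
      exact hx (by simp only [condOn]; rw [if_neg hx'])
    exact (hgood i).1 x hxA
  · have hyB : y ∈ (L[(i : ℕ)]).B := by
      by_contra hy'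
      exact hy (by simp only [condOn]; rw [if_neg hy'])
    exact (hgood i).2.1 y hyB
  · rw [blockMass_condOn, div_le_iff₀ (hgood i).2.2.2.2.2.1]
    exact (hgood i).2.2.1 S hS ξ
  · rw [blockMass_condOn, div_le_iff₀ (hgood i).2.2.2.2.2.2]
    exact (hgood i).2.2.2.1 S hS ζ
  · -- the pointwise identity
    have hid := hrep x y
    have e0 : rectFun P Q univ univ x y = P x * Q y := by simp [rectFun]
    rw [e0] at hid
    rw [hid, hEdmul x y]
    congr 1
    rw [sum_fin_getElem_eq_sum_map (fun R : Rect n b =>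
      massOn P R.A * massOn Q R.B * (condOn P R.A x * condOn Q R.B y)) L]
    refine congrArg List.sum (List.map_congr_left fun R hR => ?_)
    have hg := hL R hR
    have hA := hg.2.2.2.2.2.1
    have hB := hg.2.2.2.2.2.2
    unfold rectFun condOn
    by_cases hx : x ∈ R.A
    · by_cases hy : y ∈ R.B
      · rw [if_pos ⟨hx, hy⟩, if_pos hx, if_pos hy]
        field_simp
      · rw [if_neg (fun h => hy h.2), if_neg hy]; ring
    · rw [if_neg (fun h => hx h.1), if_neg hx]; ring

end Assembly

/-! ### Theorem 2.11 / 6.4 (product case) — PROVED; Theorem 1.10 unconditional -/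

section Theorem211

variable {n b : ℕ} {P Q : (Fin n → Fin b → Bool) → ℝ}

/-- From the product hypothesis `(2^{bn}P x)(2^{bn}Q y) ≤ T` to the one-sided `2^{bn} P x ≤ T` (as
`max_y 2^{bn} Q y ≥ 1`). [cite: KothariMekaRaghavendra2017, §6.2 ("H_∞(X)+H_∞(Y) ≥ 2n log q − t")] -/
theorem pow_mul_le_of_prod_le (hP0 : ∀ x, 0 ≤ P x) (hQ1 : ∑ y, Q y = 1) {T : ℝ}
    (hT : ∀ x y, ((2 : ℝ) ^ (b * n) * P x) * ((2 : ℝ) ^ (b * n) * Q y) ≤ T) (x : Fin n → Fin b → Bool) :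
    (2 : ℝ) ^ (b * n) * P x ≤ T := by
  classical
  obtain ⟨y₀, -, hy₀⟩ := Finset.exists_max_image (univ : Finset (Fin n → Fin b → Bool)) Q
    ⟨fun _ _ => false, mem_univ _⟩
  have hMQ1 : 1 ≤ (2 : ℝ) ^ (b * n) * Q y₀ := by
    have : ∑ y, Q y ≤ ∑ _y : Fin n → Fin b → Bool, Q y₀ := sum_le_sum fun y _ => hy₀ y (mem_univ _)
    rw [hQ1, Finset.sum_const, card_univ, Fintype.card_fun, Fintype.card_fun, Fintype.card_bool,
      Fintype.card_fin, Fintype.card_fin, nsmul_eq_mul] at this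
    rw [pow_mul]
    exact_mod_cast this
  have h0 : 0 ≤ (2 : ℝ) ^ (b * n) * P x := mul_nonneg (by positivity) (hP0 x)
  calc (2 : ℝ) ^ (b * n) * P x ≤ ((2 : ℝ) ^ (b * n) * P x) * ((2 : ℝ) ^ (b * n) * Q y₀) :=
        le_mul_of_one_le_right h0 hMQ1
    _ ≤ T := hT x y₀

/-- If `P` itself is not `σ^{16}`-blockwise-dense then `T > σ^{−4} = q^{0.2}`: a heavy `(J, ξ)` has
`q^{−0.8|J|} < Pr[X_J = ξ] ≤ 2^{−b|J|} T`. [cite: KothariMekaRaghavendra2017, §6.3–6.4 (Claim 6.3 at the root)] -/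
theorem one_lt_of_not_denseOn_univ {σ T : ℝ} (hσ0 : 0 < σ) (hσ1 : σ ≤ 1) (hσb : σ ^ 20 * 2 ^ b = 1)
    (hP0 : ∀ x, 0 ≤ P x) (hP1 : ∑ x, P x = 1) (hPb : ∀ x, (2 : ℝ) ^ (b * n) * P x ≤ T)
    (h : ¬ DenseOn (σ ^ 16) P univ ∅) : 1 < σ ^ 4 * T := by
  classical
  obtain ⟨J, ξ, -, hJ1, hlt⟩ := exists_heavy_of_not_denseOn hP0 h
  have hm1 : massOn P univ = 1 := by unfold massOn; exact hP1
  rw [hm1, mul_one, bmassOn_eq_massOn_filter] at hlt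
  set A₁ := (univ : Finset (Fin n → Fin b → Bool)).filter (fun x => blockRestrict J x = ξ) with hA₁
  have hpos : 0 < massOn P A₁ := lt_of_le_of_lt (by positivity) hlt
  have hne : A₁.Nonempty := by
    by_contra hne
    rw [Finset.not_nonempty_iff_eq_empty] at hne
    rw [hne] at hpos; simp [massOn] at hpos
  obtain ⟨x₁, hx₁⟩ := hne
  have hfix : FixedOn A₁ (∅ ∪ J) x₁ :=
    fixedOn_filter_union (A := univ) (F := ∅) (α := x₁) (fun x _ j hj => absurd hj (Finset.notMem_empty j)) hx₁
  have hbound := pow_mul_massOn_le_of_fixedOn hP0 hPb hfix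
  rw [Finset.empty_union] at hbound
  -- `(2^b σ^16)^{|J|} < T` and `2^b σ^16 = 1/σ^4 ≥ 1`
  have e : (2 : ℝ) ^ b * σ ^ 16 = 1 / σ ^ 4 := by
    rw [eq_div_iff (pow_pos hσ0 4).ne']
    calc (2 : ℝ) ^ b * σ ^ 16 * σ ^ 4 = σ ^ 20 * 2 ^ b := by ring
      _ = 1 := hσb
  have h1 : (1 / σ ^ 4) ^ J.card < T := by
    rw [← e, mul_pow, ← pow_mul]
    calc ((2 : ℝ) ^ (b * J.card)) * (σ ^ 16) ^ J.card < (2 : ℝ) ^ (b * J.card) * massOn P A₁ :=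
          mul_lt_mul_of_pos_left hlt (by positivity)
      _ ≤ T := hbound
  have h2 : 1 / σ ^ 4 ≤ (1 / σ ^ 4) ^ J.card :=
    le_self_pow₀ (by rw [le_div_iff₀ (pow_pos hσ0 4), one_mul]; exact pow_le_one₀ hσ0.le hσ1) (by omega)
  have h3 : 1 / σ ^ 4 < T := lt_of_le_of_lt h2 h1
  rw [div_lt_iff₀ (pow_pos hσ0 4)] at h3
  linarith

/-- The final arithmetic of Theorem 6.4: `d σ^d + T σ^{4d} (d ln(1/σ) + 1)^d ≤ T (dσ)^d` for `d ≥ 3`, `T ≥ 1`,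
`0 < σ ≤ 1` (via `e^{3u} ≥ 1 + 3u`, so `σ^3 (d ln(1/σ) + 1) ≤ d/3`). [cite: KothariMekaRaghavendra2017, §6.4 (last display: "dδ + q^{−.1d} 2^t (⌈log 1/δ⌉+2)^d ≤ 2^t (d q^{−.05})^d for δ = q^{−0.05d}")] -/
theorem KMR_thm64_final_arith {σ T : ℝ} (hσ0 : 0 < σ) (hσ1 : σ ≤ 1) (hT1 : 1 ≤ T) {d : ℕ} (hd : 3 ≤ d) :
    (d : ℝ) * σ ^ d + T * σ ^ (4 * d) * (Real.log (1 / σ ^ d) + 1) ^ d ≤ T * ((d : ℝ) * σ) ^ d := by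
  have hd0 : (3 : ℝ) ≤ d := by exact_mod_cast hd
  set u : ℝ := Real.log (1 / σ) with hu
  have hu0 : 0 ≤ u := Real.log_nonneg (by rw [le_div_iff₀ hσ0]; linarith)
  have hL : Real.log (1 / σ ^ d) + 1 = d * u + 1 := by
    rw [hu, ← Real.log_pow, one_div_pow]
  rw [hL]
  -- `σ^3 (3u + 1) ≤ 1`
  have hexp : 3 * u + 1 ≤ (1 / σ) ^ 3 := by
    have h1 := Real.add_one_le_exp (3 * u)
    have h2 : Real.exp (3 * u) = (1 / σ) ^ 3 := by
      rw [hu, show (3 : ℝ) * Real.log (1 / σ) = Real.log ((1 / σ) ^ 3) by rw [Real.log_pow]; norm_num,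
        Real.exp_log (by positivity)]
    linarith [h2.symm.le]
  have hσ3 : σ ^ 3 * (3 * u + 1) ≤ 1 := by
    have := mul_le_mul_of_nonneg_left hexp (pow_nonneg hσ0.le 3)
    rw [one_div_pow, mul_one_div, div_self (pow_pos hσ0 3).ne'] at this
    exact this
  -- `σ^3 (d u + 1) ≤ d/3`
  have hkey : σ ^ 3 * (d * u + 1) ≤ d / 3 := by
    have hσ30 : 0 ≤ σ ^ 3 := pow_nonneg hσ0.le 3
    nlinarith [mul_nonneg hσ30 hu0]
  have hkey0 : 0 ≤ σ ^ 3 * (d * u + 1) := by positivity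
  -- `(σ^3 L)^d ≤ (d/3)^d ≤ d^d / 9`
  have hpow : (σ ^ 3 * (d * u + 1)) ^ d ≤ ((d : ℝ) / 3) ^ d := pow_le_pow_left₀ hkey0 hkey d
  have h9 : ((d : ℝ) / 3) ^ d ≤ (d : ℝ) ^ d / 9 := by
    rw [div_pow]
    refine div_le_div_of_nonneg_left (by positivity) (by norm_num) ?_
    calc (9 : ℝ) = 3 ^ 2 := by norm_num
      _ ≤ 3 ^ d := pow_le_pow_right₀ (by norm_num) (by omega)
  have h2d : 2 * (d : ℝ) ≤ (d : ℝ) ^ d := by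
    have : 2 * d ≤ d ^ d := by
      calc 2 * d ≤ d * d := Nat.mul_le_mul_right d (by omega)
        _ = d ^ 2 := (sq d).symm
        _ ≤ d ^ d := Nat.pow_le_pow_right (by omega) (by omega)
    exact_mod_cast this
  -- assemble
  have e1 : T * σ ^ (4 * d) * (d * u + 1) ^ d = T * σ ^ d * (σ ^ 3 * (d * u + 1)) ^ d := by
    rw [mul_pow, ← pow_mul, show 4 * d = d + 3 * d by ring, pow_add]; ring
  rw [e1, show ((d : ℝ) * σ) ^ d = (d : ℝ) ^ d * σ ^ d from mul_pow _ _ _]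
  have hσd : 0 < σ ^ d := pow_pos hσ0 d
  have hA : (d : ℝ) * σ ^ d ≤ T * σ ^ d * d := by
    calc (d : ℝ) * σ ^ d = 1 * σ ^ d * d := by ring
      _ ≤ T * σ ^ d * d := mul_le_mul_of_nonneg_right (mul_le_mul_of_nonneg_right hT1 hσd.le) (Nat.cast_nonneg d)
  have hB : T * σ ^ d * (σ ^ 3 * (d * u + 1)) ^ d ≤ T * σ ^ d * ((d : ℝ) ^ d / 9) :=
    mul_le_mul_of_nonneg_left (hpow.trans h9) (by positivity)
  have hC : T * σ ^ d * d + T * σ ^ d * ((d : ℝ) ^ d / 9) ≤ T * ((d : ℝ) ^ d * σ ^ d) := by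
    have : (d : ℝ) + (d : ℝ) ^ d / 9 ≤ (d : ℝ) ^ d := by linarith
    have hTσ : 0 ≤ T * σ ^ d := by positivity
    nlinarith
  linarith

/-- **Kothari–Meka–Raghavendra 2017, Theorem 2.11 / Theorem 6.4 (product case) — PROVED**, discharging the
typed fact `KothariMekaRaghavendra2017_thm211` of `NonnegativeRankConicalJuntas.lean`: with `q = 2^b`, if
`(q^n P x)(q^n Q y) ≤ 2^t` then `P ⊗ Q` is a convex combination of aligned conjunctive `q^{−0.8}`-blockwise-dense
pairs of degree `≤ d` plus an error of weight `≤ 2^t (d q^{−0.05})^d`. Proof = the decomposition algorithm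
of §6.3 (`hasRectDecomp_depth` at the root with `δ = q^{−0.05d}`), the assembly `hasAlignedDecomposition_of_
hasRectDecomp`, and the final arithmetic (`KMR_thm64_final_arith`, in the regime `d ≥ 5`, `2^t > q^{0.2}` —
the complementary regimes are trivial: error weight `≥ 1`, or `P, Q` already blockwise-dense).
[cite: KothariMekaRaghavendra2017, Thm 2.11 (§2.3) = Thm 6.4 (§6.2) with its proof §6.3–6.4] -/
theorem KothariMekaRaghavendra2017_thm211_holds : KothariMekaRaghavendra2017_thm211 := by
  classical
  intro n b t d P Q hP0 hP1 hQ0 hQ1 hT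
  set σ : ℝ := (2 : ℝ) ^ (-(1 / 20 : ℝ) * b) with hσ
  have hσ0 : 0 < σ := Real.rpow_pos_of_pos two_pos _
  have hσ1 : σ ≤ 1 := Real.rpow_le_one_of_one_le_of_nonpos (by norm_num)
    (mul_nonpos_of_nonpos_of_nonneg (by norm_num) (Nat.cast_nonneg b))
  have hσb : σ ^ 20 * 2 ^ b = 1 := by
    rw [hσ, ← Real.rpow_natCast, ← Real.rpow_mul two_pos.le, ← Real.rpow_natCast (2 : ℝ) b,
      ← Real.rpow_add two_pos]
    rw [show (-(1 / 20 : ℝ) * b) * ((20 : ℕ) : ℝ) + (b : ℝ) = 0 by push_cast; ring, Real.rpow_zero]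
  have hθ : (2 : ℝ) ^ (-(4 / 5 : ℝ) * b) = σ ^ 16 := by
    rw [hσ, ← Real.rpow_natCast (2 ^ _), ← Real.rpow_mul two_pos.le]
    congr 1; push_cast; ring
  rw [hθ]
  set T : ℝ := (2 : ℝ) ^ t with hTdef
  have hT0 : 0 < T := Real.rpow_pos_of_pos two_pos t
  -- regime A: the error bound is `≥ 1`
  by_cases hA : 1 ≤ T * ((d : ℝ) * σ) ^ d
  · exact hasAlignedDecomposition_of_one_le _ _ d hA hP0 hP1 hQ0 hQ1
  -- regime B: both marginals already blockwise-dense — one piece, no error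
  by_cases hB : DenseOn (σ ^ 16) P univ ∅ ∧ DenseOn (σ ^ 16) Q univ ∅
  · have hgood : (⟨univ, univ, ∅, fun _ _ => false, fun _ _ => false⟩ : Rect n b).Good (σ ^ 16) d P Q :=
      ⟨fun x _ j hj => absurd hj (Finset.notMem_empty j), fun y _ j hj => absurd hj (Finset.notMem_empty j),
        hB.1, hB.2, by simp, by unfold massOn; rw [hP1]; exact one_pos, by unfold massOn; rw [hQ1]; exact one_pos⟩
    exact (hasAlignedDecomposition_of_hasRectDecomp hP0 hP1 hQ0 hQ1 (hasRectDecomp_good hgood)).mono_err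
      (by positivity)
  -- regime C: the algorithm.  First `T > σ^{-4} ≥ 1` and `d ≥ 5`.
  have hPb := pow_mul_le_of_prod_le hP0 hQ1 hT
  have hQb : ∀ y, (2 : ℝ) ^ (b * n) * Q y ≤ T :=
    pow_mul_le_of_prod_le hQ0 hP1 (fun y x => by rw [mul_comm]; exact hT x y)
  have hσT : 1 < σ ^ 4 * T := by
    rcases not_and_or.1 hB with h | h
    · exact one_lt_of_not_denseOn_univ hσ0 hσ1 hσb hP0 hP1 hPb h
    · exact one_lt_of_not_denseOn_univ hσ0 hσ1 hσb hQ0 hQ1 hQb h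
  have hσ4 : σ ^ 4 ≤ 1 := pow_le_one₀ hσ0.le hσ1
  have hT1 : 1 < T := by nlinarith
  have hd5 : 5 ≤ d := by
    by_contra hlt
    apply hA
    have hd4 : d ≤ 4 := by omega
    rcases Nat.eq_zero_or_pos d with hd0 | hdpos
    · subst hd0; simp only [pow_zero, mul_one]; exact hT1.le
    · have h1 : σ ^ 4 ≤ ((d : ℝ) * σ) ^ d := by
        rw [mul_pow]
        have h3 : (1 : ℝ) ≤ (d : ℝ) ^ d := one_le_pow₀ (by exact_mod_cast hdpos)
        have h2 : σ ^ 4 ≤ σ ^ d := pow_le_pow_of_le_one hσ0.le hσ1 hd4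
        nlinarith [pow_pos hσ0 d]
      nlinarith
  -- run `Decompose([q]^n × [q]^n, ∅)` with `δ = σ^d`
  have hδ0 : 0 < σ ^ d := pow_pos hσ0 d
  have hδ1 : σ ^ d ≤ 1 := pow_le_one₀ hσ0.le hσ1
  have hdec := hasRectDecomp_depth hσ0 hσ1 hσb hδ0 hδ1 (le_refl (Real.log (1 / σ ^ d) + 1)) (d := d)
    hP0 hQ0 hQ1 hT d ∅ (by simp) univ univ (fun _ _ => false) (fun _ _ => false)
    (fun x _ j hj => absurd hj (Finset.notMem_empty j)) (fun y _ j hj => absurd hj (Finset.notMem_empty j))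
  have hmass : massOn P univ * massOn Q univ = 1 := by unfold massOn; rw [hP1, hQ1, mul_one]
  rw [hmass, Finset.card_empty, Nat.sub_zero, pow_zero, mul_one, mul_one] at hdec
  refine (hasAlignedDecomposition_of_hasRectDecomp hP0 hP1 hQ0 hQ1 hdec).mono_err ?_
  exact KMR_thm64_final_arith hσ0 hσ1 hT1.le (by omega)

/-- **Kothari–Meka–Raghavendra 2017, Theorem 1.10 — PROVED unconditionally** (discharging the engine fact
`KothariMekaRaghavendra2017_thm110` of `LPRelaxationsMaxCSP.lean`): `KothariMekaRaghavendra2017_thm110_of_thm211`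
(Lemma 2.3 + Lemma 2.4 + §4–§5, `NonnegativeRankConicalJuntas.lean`) fed with the decomposition theorem just
proved. [cite: KothariMekaRaghavendra2017, Thm 1.10 (§1.2) with its proof §2 (Lemmas 2.3, 2.4) and §4–§6] -/
theorem KothariMekaRaghavendra2017_thm110_holds : KothariMekaRaghavendra2017_thm110 :=
  KothariMekaRaghavendra2017_thm110_of_thm211 KothariMekaRaghavendra2017_thm211_holds

end Theorem211

end Literature.Combinatorics.Optimization

end
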